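import Summits.KontsevichZagierPeriods.KontsevichZagierPeriods.Theorems.IsogenyCertificatesXMapKernelStubCMClassEtaAux
import Literature.NumberTheory.Transcendental.KontsevichZagierGammaProofs

/-!
# `XMapKernel`, line `derived-datum-quasi-periods` — stub **H2-CM** (`stub_cmClassEta`):
# class independence with quasi-periods, the CM class

Support file for the crux `IsogenyCertificates.XMapKernel` (stmt-KontsevichZagierPeriods-10663),
line `derived-datum-quasi-periods`, stub `stub_cmClassEta` (registration 2, H2-CM). Together
with the landed non-CM half (`EtaIndependence.classIndependence_nonCM`) and the glue
`EtaIndependence.classIndependence_of_cm` it discharges hypothesis H2 (class independence) of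
`EtaIndependence.stub_etaIndependence_of`.

**Statement (H2-CM).** Let `Λⱼ` (`j ∈ S`) be lattices WITH complex multiplication and rational
invariants, pairwise isogenous and pairwise (for `i ≠ j`) without rational multiplier, and let
`Ωⱼ = aⱼω₁ + bⱼω₂ ∈ Λⱼ` be non-zero real lattice vectors with quasi-periods
`Hⱼ = aⱼη₁ + bⱼη₂`. Then a vanishing `ℚ`-combination `∑ⱼ (pⱼΩⱼ + qⱼHⱼ) = 0` is trivial.

**Proof.** Fix `i₀ ∈ S` and write `Λ₀ = Λ_{i₀}` in a basis whose first vector is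
`u = Ω₀(Λ_{i₀}) > 0` (`PeriodPair.IsReal.exists_lattice_eq_ω₁_eq`); so `ω₁(Λ₀) = u` and
`η₁(Λ₀) = η(u)`; `Λ₀` has rational invariants and CM, with CM multiplier `τ ∉ ℝ`
(`CMClass.exists_cm_multiplier`). For `j ∈ S` pick a multiplier `αⱼΛ₀ ⊆ Λⱼ`; the auxiliary
file (`cm_package`) gives `Nⱼ ≥ 1` with `Nⱼτ` a multiplier of `Λⱼ`, `Λⱼ ⊆ (ℚ + ℚτ)wⱼ`
(`wⱼ = Ω₀(Λⱼ)`), and `ρⱼ^{dⱼ} ∈ ℚ` for `ρⱼ = wⱼ/u > 0`; commensurable `ρⱼ, ρⱼ'` would give a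
rational multiplier `Λⱼ → Λⱼ'`, so the ratios `ρⱼ/ρⱼ'` are irrational. Now `Ωⱼ = κⱼwⱼ`
(`κⱼ ∈ ℤ ∖ 0`) and `DⱼΛⱼ ⊆ ℤwⱼ + ℤNⱼτwⱼ` (`exists_nat_mul_eq_comb`), so the REAL number
`γⱼ = Dⱼ/ρⱼ` is a multiplier `Λⱼ → Λ₀` with `γⱼΩⱼ = Dⱼκⱼu`. Quasi-period transport along `γⱼ`
(`IsotypicSplitting.quasiPeriod_transport`) gives `N'ⱼHⱼ = γⱼDⱼκⱼ·η(u) − sⱼΩⱼ` with `sⱼ`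
algebraic, so the relation reads `X·u + Y·η(u) = 0` with algebraic
`X = ∑ (pⱼ − qⱼsⱼ/N'ⱼ)κⱼρⱼ`, `Y = ∑ (qⱼDⱼ²κⱼ/N'ⱼ)ρⱼ⁻¹`. Masser's Theorem III
(`indep_ω₁_η₁`) gives `X = Y = 0`; radical independence (R-b4, `radical_indep_finset_pow`)
applied to the `ρⱼ⁻¹` gives `qⱼ = 0`, and then applied to the `ρⱼ` gives `pⱼ = 0`.

References: D. Masser, *Elliptic Functions and Transcendence*, LNM 437 (1975), Ch. III
Thm. III and Lemma 3.1; D. A. Cox, *Primes of the form x² + ny²* (2013), §10.C; L. J. Mordell,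
Pacific J. Math. 3 (1953), Thm. 1.
-/

noncomputable section

namespace Summit.KontsevichZagierPeriods.IsogenyCertificates.XMapKernelStubs.CMClassEta

open scoped BigOperators
open Complex Literature.NumberTheory.Transcendental
open Summit.KontsevichZagierPeriods.IsogenyCertificates.XMapKernelStubs.CMClass

/-- **H2-CM — class independence with quasi-periods, CM class.** For finitely many CM
lattices `Λⱼ` (`j ∈ S`) with rational invariants, pairwise isogenous and pairwise without
rational multiplier, non-zero real lattice vectors `Ωⱼ = aⱼω₁ + bⱼω₂` and their quasi-periods
`Hⱼ = aⱼη₁ + bⱼη₂`: a vanishing `ℚ`-combination `∑ⱼ (pⱼΩⱼ + qⱼHⱼ) = 0` is trivial. Proof in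
the module docstring (Masser's Theorem III on a base lattice with first period `Ω₀`, real
multipliers `Λⱼ → Λ₀`, quasi-period transport, radical independence).
[cite: Masser1975, Ch. III Thm. III and Lemma 3.1] -/
theorem stub_cmClassEta : ∀ (k : ℕ) (S : Finset (Fin k)) (L : Fin k → PeriodPair) (a b : Fin k → ℤ) (p q : Fin k → ℚ), (∀ j ∈ S, (L j).HasCM) → (∀ j ∈ S, (∃ r : ℚ, (r : ℂ) = (L j).g₂) ∧ (∃ r : ℚ, (r : ℂ) = (L j).g₃)) → (∀ j ∈ S, ((a j : ℂ) * (L j).ω₁ + (b j : ℂ) * (L j).ω₂).im = 0 ∧ (a j : ℂ) * (L j).ω₁ + (b j : ℂ) * (L j).ω₂ ≠ 0) → (∀ i ∈ S, ∀ j ∈ S, (L i).IsIsogenousTo (L j)) → (∀ i ∈ S, ∀ j ∈ S, i ≠ j → ¬ ∃ c : ℚ, c ≠ 0 ∧ ∀ l ∈ (L i).lattice, (c : ℂ) * l ∈ (L j).lattice) → ∑ j ∈ S, ((p j : ℂ) * ((a j : ℂ) * (L j).ω₁ + (b j : ℂ) * (L j).ω₂) + (q j : ℂ) * ((a j : ℂ)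 * (L j).η₁ + (b j : ℂ) * (L j).η₂)) = 0 → ∀ j ∈ S, p j = 0 ∧ q j = 0 := by
  intro k S L a b p q hCMall hrat hper hiso hnrm hsum
  classical
  -- (0) realness and algebraicity of the invariants
  have hLreal : ∀ j ∈ S, (L j).IsReal := fun j hj => by
    obtain ⟨⟨r₂, hr₂⟩, ⟨r₃, hr₃⟩⟩ := hrat j hj
    exact PeriodPair.isReal_of_g₂_g₃_real PeriodPair.uniformization_unique_holds
      (by rw [← hr₂]; exact ratCast_im r₂) (by rw [← hr₃]; exact ratCast_im r₃)
  have hLalg : ∀ j ∈ S, IsAlgebraic ℚ (L j).g₂ ∧ IsAlgebraic ℚ (L j).g₃ := fun j hj => by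
    obtain ⟨⟨r₂, hr₂⟩, ⟨r₃, hr₃⟩⟩ := hrat j hj
    exact ⟨by rw [← hr₂]; exact isAlgebraic_algebraMap r₂, by rw [← hr₃]; exact isAlgebraic_algebraMap r₃⟩
  rcases S.eq_empty_or_nonempty with hS | ⟨i₀, hi₀⟩
  · intro j hj
    simp [hS] at hj
  -- (1) the base lattice `Λ₀ = Λ_{i₀}` in a basis with first vector `u = Ω₀(Λ_{i₀})`
  obtain ⟨L₀, hL₀, hω₁⟩ := (hLreal i₀ hi₀).exists_lattice_eq_ω₁_eq
  obtain ⟨u, hu_def⟩ : ∃ u : ℝ, u = (L i₀).minRealPeriod := ⟨_, rfl⟩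
  have hu : 0 < u := by rw [hu_def]; exact (hLreal i₀ hi₀).minRealPeriod_pos
  have huω : L₀.ω₁ = (u : ℂ) := by rw [hω₁, hu_def]
  have huL : (u : ℂ) ∈ L₀.lattice := huω ▸ L₀.ω₁_mem_lattice
  have huc : (u : ℂ) ≠ 0 := by exact_mod_cast hu.ne'
  have hg₂ : ∃ r : ℚ, (r : ℂ) = L₀.g₂ := by
    rw [PeriodPair.g₂_eq_of_lattice_eq hL₀]; exact (hrat i₀ hi₀).1
  have hg₃ : ∃ r : ℚ, (r : ℂ) = L₀.g₃ := by
    rw [PeriodPair.g₃_eq_of_lattice_eq hL₀]; exact (hrat i₀ hi₀).2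
  have hCM₀ : L₀.HasCM := by
    obtain ⟨t, htZ, htL⟩ := hCMall i₀ hi₀
    exact ⟨t, htZ, by rw [hL₀]; exact htL⟩
  -- (2) the CM multiplier `τ` of `Λ₀` and the multipliers `αⱼΛ₀ ⊆ Λⱼ`
  obtain ⟨τ, p₀, q₀, hτ, hτL, hquad⟩ := exists_cm_multiplier hCM₀
  have hmem' : ∀ j ∈ S, ∃ α : ℂ, α ≠ 0 ∧ ∀ l ∈ L₀.lattice, α * l ∈ (L j).lattice := by
    intro j hj
    obtain ⟨α, hα, hαL⟩ := hiso i₀ hi₀ j hj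
    exact ⟨α, hα, fun l hl => hαL l (by rw [← hL₀]; exact hl)⟩
  choose! α hα0 hαL using hmem'
  -- (3) the radical structure of the class (auxiliary file)
  have hpack : ∀ j ∈ S, ∃ N : ℕ, N ≠ 0 ∧
      (∀ y ∈ (L j).lattice, (N : ℂ) * τ * y ∈ (L j).lattice) ∧
      (∀ y ∈ (L j).lattice, ∃ a' b' : ℚ, y = ((a' : ℂ) + b' * τ) * (L j).minRealPeriod) ∧
      ∃ d : ℕ, 0 < d ∧ ∃ r : ℚ, ((L j).minRealPeriod / u) ^ d = (r : ℝ) := fun j hj =>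
    cm_package hg₂ hg₃ (hrat j hj).1 (hrat j hj).2 hτ hτL hquad hu huL (hLreal j hj) (hα0 j hj)
      (hαL j hj)
  choose! N hN0 hτj hΛj d hd hdr using hpack
  obtain ⟨w, hw⟩ : ∃ w : Fin k → ℝ, ∀ j, w j = (L j).minRealPeriod := ⟨_, fun j => rfl⟩
  have hwpos : ∀ j ∈ S, 0 < w j := fun j hj => by rw [hw]; exact (hLreal j hj).minRealPeriod_pos
  have hwL : ∀ j ∈ S, ((w j : ℝ) : ℂ) ∈ (L j).lattice := fun j hj => by
    rw [hw]; exact (hLreal j hj).minRealPeriod_mem_lattice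
  obtain ⟨ρ, hρ⟩ : ∃ ρ : Fin k → ℝ, ∀ j, ρ j = w j / u := ⟨_, fun j => rfl⟩
  have hρpos : ∀ j ∈ S, 0 < ρ j := fun j hj => by rw [hρ]; exact div_pos (hwpos j hj) hu
  have hρw : ∀ j, (w j : ℂ) = ρ j * u := fun j => by rw [hρ]; push_cast; field_simp
  have hm : 0 < ∏ j ∈ S, d j := Finset.prod_pos fun j hj => hd j hj
  have hxm : ∀ j ∈ S, ∃ a' : ℚ, ρ j ^ (∏ i ∈ S, d i) = (a' : ℝ) := by
    intro j hj
    obtain ⟨r, hr⟩ := hdr j hj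
    rw [← hw j, ← hρ j] at hr
    obtain ⟨e, he⟩ : d j ∣ ∏ i ∈ S, d i := Finset.dvd_prod_of_mem d hj
    exact ⟨r ^ e, by rw [he, pow_mul, hr, Rat.cast_pow]⟩
  have hρalg : ∀ j ∈ S, IsAlgebraic ℚ (ρ j : ℂ) := by
    intro j hj
    obtain ⟨a', ha'⟩ := hxm j hj
    refine IsAlgebraic.of_pow (n := ∏ i ∈ S, d i) hm ?_
    have h1 : (ρ j : ℂ) ^ (∏ i ∈ S, d i) = (a' : ℂ) := by
      rw [← ofReal_ratCast]
      exact_mod_cast congrArg ((↑) : ℝ → ℂ) ha'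
    rw [h1]
    exact isAlgebraic_algebraMap a'
  -- (4) no rational multiplier ⇒ pairwise irrational ratios
  have hirr : ∀ j ∈ S, ∀ j' ∈ S, j ≠ j' → ¬ ∃ c : ℚ, ρ j = (c : ℝ) * ρ j' := by
    rintro j hj j' hj' hne ⟨c, hc⟩
    have hww : (w j : ℂ) = (c : ℂ) * w j' := by
      rw [hρw, hρw]
      have : (ρ j : ℂ) = (c : ℂ) * ρ j' := by exact_mod_cast congrArg ((↑) : ℝ → ℂ) hc
      rw [this, mul_assoc]
    have hgen : ∀ y ∈ (L j).lattice, ∃ D : ℕ, D ≠ 0 ∧ (D : ℂ) * y ∈ (L j').lattice := by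
      intro y hy
      obtain ⟨a', b', hab⟩ := hΛj j hj y hy
      rw [← hw j] at hab
      have hNc : (N j' : ℂ) ≠ 0 := by exact_mod_cast hN0 j' hj'
      have e : y = ((a' * c : ℚ) : ℂ) * (w j' : ℂ) +
          ((b' * c / N j' : ℚ) : ℂ) * ((N j' : ℂ) * τ * w j') := by
        rw [hab, hww]
        push_cast
        field_simp
      rw [e]
      exact exists_nat_mul_qcomb_mem (hwL j' hj') (hτj j' hj' _ (hwL j' hj')) _ _
    obtain ⟨D₁, hD₁, hD₁L⟩ := hgen _ (L j).ω₁_mem_lattice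
    obtain ⟨D₂, hD₂, hD₂L⟩ := hgen _ (L j).ω₂_mem_lattice
    refine hnrm j hj j' hj' hne ⟨((D₁ * D₂ : ℕ) : ℚ), by exact_mod_cast mul_ne_zero hD₁ hD₂,
      fun l hl => ?_⟩
    obtain ⟨m₁, m₂, rfl⟩ := PeriodPair.mem_lattice.1 hl
    have e : (((D₁ * D₂ : ℕ) : ℚ) : ℂ) * ((m₁ : ℂ) * (L j).ω₁ + m₂ * (L j).ω₂)
        = ((m₁ * D₂ : ℤ) : ℂ) * ((D₁ : ℂ) * (L j).ω₁) +
          ((m₂ * D₁ : ℤ) : ℂ) * ((D₂ : ℂ) * (L j).ω₂) := by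
      push_cast
      ring
    rw [e]
    exact add_mem (intCast_mul_mem _ hD₁L) (intCast_mul_mem _ hD₂L)
  -- (5) the given real periods `Ωⱼ = κⱼwⱼ`, `κⱼ ∈ ℤ ∖ 0`
  have hκ : ∀ j ∈ S, ∃ κ : ℤ, κ ≠ 0 ∧
      (a j : ℂ) * (L j).ω₁ + (b j : ℂ) * (L j).ω₂ = (κ : ℂ) * (w j : ℂ) := by
    intro j hj
    obtain ⟨him, hne⟩ := hper j hj
    have hΩre : ((((a j : ℂ) * (L j).ω₁ + (b j : ℂ) * (L j).ω₂).re : ℝ) : ℂ) =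
        (a j : ℂ) * (L j).ω₁ + (b j : ℂ) * (L j).ω₂ := Complex.ext (by simp) (by simp [him])
    have hmemΩ : ((((a j : ℂ) * (L j).ω₁ + (b j : ℂ) * (L j).ω₂).re : ℝ) : ℂ) ∈
        (L j).lattice := by
      rw [hΩre]
      exact PeriodPair.mem_lattice.2 ⟨a j, b j, rfl⟩
    obtain ⟨κ, hκ⟩ := (hLreal j hj).exists_eq_int_mul hmemΩ
    refine ⟨κ, ?_, ?_⟩
    · rintro rfl
      apply hne
      rw [← hΩre, hκ]
      simp
    · rw [← hΩre, hκ, ← hw j]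
      push_cast
      ring
  choose! κ hκ0 hκΩ using hκ
  -- (6) the real multipliers `γⱼ = Dⱼ/ρⱼ : Λⱼ → Λ₀`
  have hD : ∀ j ∈ S, ∃ D : ℕ, D ≠ 0 ∧
      ∀ y ∈ (L j).lattice, (D : ℂ) * ((ρ j : ℂ))⁻¹ * y ∈ L₀.lattice := by
    intro j hj
    have hτ'' : ((N j : ℂ) * τ).im ≠ 0 := by
      rw [show ((N j : ℂ) * τ).im = (N j : ℝ) * τ.im by simp]
      exact mul_ne_zero (by exact_mod_cast hN0 j hj) hτ
    obtain ⟨D, hD, hDL⟩ := exists_nat_mul_eq_comb hτ'' (hτj j hj) (hwpos j hj).ne' (hwL j hj)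
    refine ⟨D, hD, fun y hy => ?_⟩
    obtain ⟨m, n, hmn⟩ := hDL y hy
    have hρc : (ρ j : ℂ) ≠ 0 := by exact_mod_cast (hρpos j hj).ne'
    have e : (D : ℂ) * ((ρ j : ℂ))⁻¹ * y = (m : ℂ) * (u : ℂ) + ((n * N j : ℤ) : ℂ) * (τ * u) := by
      have h1 : (D : ℂ) * ((ρ j : ℂ))⁻¹ * y = ((ρ j : ℂ))⁻¹ * ((D : ℂ) * y) := by ring
      rw [h1, hmn, hρw]
      push_cast
      linear_combination ((m : ℂ) * u + (n : ℂ) * (N j : ℂ) * (τ * u)) * inv_mul_cancel₀ hρc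
    rw [e]
    exact add_mem (intCast_mul_mem _ huL) (intCast_mul_mem _ (hτL _ huL))
  choose! D hD0 hDL using hD
  obtain ⟨γ, hγ⟩ : ∃ γ : Fin k → ℂ, ∀ j, γ j = (D j : ℂ) * ((ρ j : ℂ))⁻¹ := ⟨_, fun j => rfl⟩
  have hγL : ∀ j ∈ S, ∀ y ∈ (L j).lattice, γ j * y ∈ L₀.lattice := fun j hj y hy => by
    rw [hγ]; exact hDL j hj y hy
  have hγ0 : ∀ j ∈ S, γ j ≠ 0 := fun j hj => by
    rw [hγ]
    exact mul_ne_zero (by exact_mod_cast hD0 j hj)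
      (inv_ne_zero (by exact_mod_cast (hρpos j hj).ne'))
  -- (7) quasi-period transport along `γⱼ`: `N'ⱼHⱼ = γⱼDⱼκⱼ·η₁(Λ₀) − sⱼΩⱼ`
  have hH : ∀ j ∈ S, ∃ (N' : ℕ) (s : ℂ), 0 < N' ∧ IsAlgebraic ℚ s ∧
      (N' : ℂ) * ((a j : ℂ) * (L j).η₁ + (b j : ℂ) * (L j).η₂) =
        γ j * ((D j : ℂ) * (κ j : ℂ)) * L₀.η₁ -
          s * ((a j : ℂ) * (L j).ω₁ + (b j : ℂ) * (L j).ω₂) := by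
    intro j hj
    obtain ⟨P, Q, hPQ⟩ := PeriodPair.mem_lattice.1 (hγL j hj _ (L j).ω₁_mem_lattice)
    obtain ⟨U, V, hUV⟩ := PeriodPair.mem_lattice.1 (hγL j hj _ (L j).ω₂_mem_lattice)
    obtain ⟨N', s, hN', hs, hη₁, hη₂⟩ :=
      IsotypicSplitting.quasiPeriod_transport (hγ0 j hj) (hγL j hj) (hLalg j hj).1
        (hLalg j hj).2 hPQ hUV
    refine ⟨N', s, hN', hs, ?_⟩
    have hγΩ : γ j * ((a j : ℂ) * (L j).ω₁ + (b j : ℂ) * (L j).ω₂) =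
        ((a j * P + b j * U : ℤ) : ℂ) * L₀.ω₁ + ((a j * Q + b j * V : ℤ) : ℂ) * L₀.ω₂ := by
      push_cast
      linear_combination (-(a j : ℂ)) * hPQ - (b j : ℂ) * hUV
    have hγΩ' : γ j * ((a j : ℂ) * (L j).ω₁ + (b j : ℂ) * (L j).ω₂) =
        ((D j * κ j : ℤ) : ℂ) * L₀.ω₁ := by
      have hρc : (ρ j : ℂ) ≠ 0 := by exact_mod_cast (hρpos j hj).ne'
      rw [hκΩ j hj, hρw, hγ, huω]
      push_cast
      linear_combination ((D j : ℂ) * (κ j : ℂ) * (u : ℂ)) * inv_mul_cancel₀ hρc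
    obtain ⟨h1, h2⟩ : ((a j * P + b j * U - D j * κ j : ℤ) : ℝ) = 0 ∧
        ((a j * Q + b j * V : ℤ) : ℝ) = 0 :=
      L₀.eq_zero_of_real_combination (by
        push_cast
        push_cast at hγΩ hγΩ'
        linear_combination -hγΩ + hγΩ')
    have h1' : ((a j * P + b j * U : ℤ) : ℂ) = (D j : ℂ) * (κ j : ℂ) := by
      have h3 : a j * P + b j * U - D j * κ j = 0 := by exact_mod_cast h1
      rw [show a j * P + b j * U = D j * κ j by linarith]
      push_cast
      ring
    have h2' : ((a j * Q + b j * V : ℤ) : ℂ) = 0 := by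
      have h3 : a j * Q + b j * V = 0 := by exact_mod_cast h2
      exact_mod_cast h3
    calc (N' : ℂ) * ((a j : ℂ) * (L j).η₁ + (b j : ℂ) * (L j).η₂)
        = γ j * (((a j * P + b j * U : ℤ) : ℂ) * L₀.η₁ + ((a j * Q + b j * V : ℤ) : ℂ) * L₀.η₂) -
            s * ((a j : ℂ) * (L j).ω₁ + (b j : ℂ) * (L j).ω₂) := by
          push_cast
          linear_combination (a j : ℂ) * hη₁ + (b j : ℂ) * hη₂
      _ = γ j * ((D j : ℂ) * (κ j : ℂ)) * L₀.η₁ -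
            s * ((a j : ℂ) * (L j).ω₁ + (b j : ℂ) * (L j).ω₂) := by
          rw [h1', h2']
          ring
  choose! N' s hN' hs hNH using hH
  -- (8) the relation as `X·u + Y·η₁(Λ₀) = 0`
  obtain ⟨Acoef, hA⟩ : ∃ Acoef : Fin k → ℂ, ∀ j,
      Acoef j = ((p j : ℂ) - (q j : ℂ) * s j / (N' j : ℂ)) * (κ j : ℂ) * (ρ j : ℂ) :=
    ⟨_, fun j => rfl⟩
  obtain ⟨c, hc⟩ : ∃ c : Fin k → ℚ, ∀ j, c j = q j * D j ^ 2 * κ j / N' j := ⟨_, fun j => rfl⟩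
  have hterm : ∀ j ∈ S, (p j : ℂ) * ((a j : ℂ) * (L j).ω₁ + (b j : ℂ) * (L j).ω₂) +
      (q j : ℂ) * ((a j : ℂ) * (L j).η₁ + (b j : ℂ) * (L j).η₂) =
      Acoef j * (u : ℂ) + (((c j : ℝ) * (ρ j)⁻¹ : ℝ) : ℂ) * L₀.η₁ := by
    intro j hj
    have hN'c : (N' j : ℂ) ≠ 0 := by exact_mod_cast (hN' j hj).ne'
    have hρc : (ρ j : ℂ) ≠ 0 := by exact_mod_cast (hρpos j hj).ne'
    have hHj : (a j : ℂ) * (L j).η₁ + (b j : ℂ) * (L j).η₂ =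
        (N' j : ℂ)⁻¹ * (γ j * ((D j : ℂ) * (κ j : ℂ)) * L₀.η₁ -
          s j * ((a j : ℂ) * (L j).ω₁ + (b j : ℂ) * (L j).ω₂)) := by
      rw [← hNH j hj, inv_mul_cancel_left₀ hN'c]
    rw [hHj, hκΩ j hj, hρw, hA, hc, hγ]
    push_cast
    field_simp
    ring
  have hsum' : (∑ j ∈ S, Acoef j) * (u : ℂ) +
      ((∑ j ∈ S, (c j : ℝ) * (ρ j)⁻¹ : ℝ) : ℂ) * L₀.η₁ = 0 := by
    rw [← hsum, Finset.sum_mul, ofReal_sum, Finset.sum_mul, ← Finset.sum_add_distrib]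
    exact Finset.sum_congr rfl fun j hj => (hterm j hj).symm
  -- (9) Masser's Theorem III: both brackets vanish
  have hsalg : ∀ j ∈ S, IsAlgebraic ℚ (Acoef j) := by
    intro j hj
    rw [hA]
    exact ((((isAlgebraic_algebraMap (p j)).sub
      (((isAlgebraic_algebraMap (q j)).mul (hs j hj)).mul (isAlgebraic_nat (N' j)).inv)).mul
      (isAlgebraic_int (κ j))).mul (hρalg j hj))
  have hAalg : IsAlgebraic ℚ (∑ j ∈ S, Acoef j) :=
    (Subalgebra.algebraicClosure ℚ ℂ).sum_mem fun j hj =>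
      (hsalg j hj : Acoef j ∈ Subalgebra.algebraicClosure ℚ ℂ)
  have hCalg : IsAlgebraic ℚ (((∑ j ∈ S, (c j : ℝ) * (ρ j)⁻¹ : ℝ) : ℂ)) := by
    push_cast
    exact (Subalgebra.algebraicClosure ℚ ℂ).sum_mem fun j hj =>
      ((isAlgebraic_algebraMap (c j)).mul (hρalg j hj).inv :
        (c j : ℂ) * ((ρ j : ℂ))⁻¹ ∈ Subalgebra.algebraicClosure ℚ ℂ)
  rw [← huω] at hsum'
  obtain ⟨hA0, hC0⟩ := indep_ω₁_η₁ hg₂ hg₃ hCM₀ hAalg hCalg hsum'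
  -- (10) the `η`-bracket: `qⱼ = 0` (radical independence of the `ρⱼ⁻¹`)
  have hC0' : ∑ j ∈ S, (c j : ℝ) * (ρ j)⁻¹ = 0 := by exact_mod_cast hC0
  have hinvpos : ∀ j ∈ S, 0 < (ρ j)⁻¹ := fun j hj => inv_pos.2 (hρpos j hj)
  have hinvpow : ∀ j ∈ S, ∃ a' : ℚ, (ρ j)⁻¹ ^ (∏ i ∈ S, d i) = (a' : ℝ) := fun j hj => by
    obtain ⟨a', ha'⟩ := hxm j hj
    exact ⟨a'⁻¹, by rw [inv_pow, ha', Rat.cast_inv]⟩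
  have hirr_inv : ∀ j ∈ S, ∀ j' ∈ S, j ≠ j' → ¬ ∃ r : ℚ, (ρ j)⁻¹ = (r : ℝ) * (ρ j')⁻¹ := by
    rintro j hj j' hj' hne ⟨r, hr⟩
    have hxj : ρ j ≠ 0 := (hρpos j hj).ne'
    have hxj' : ρ j' ≠ 0 := (hρpos j' hj').ne'
    refine hirr j' hj' j hj hne.symm ⟨r, ?_⟩
    have key : (ρ j)⁻¹ * ρ j = 1 := inv_mul_cancel₀ hxj
    have key' : (ρ j')⁻¹ * ρ j' = 1 := inv_mul_cancel₀ hxj'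
    linear_combination (ρ j * ρ j') * hr - ρ j' * key + ((r : ℝ) * ρ j) * key'
  have hq0 : ∀ j ∈ S, q j = 0 := by
    intro j hj
    have hcj := radical_indep_finset_pow (∏ i ∈ S, d i) hm k S (fun j => (ρ j)⁻¹) c hinvpos
      hinvpow hirr_inv hC0' j hj
    have hκj : (κ j : ℚ) ≠ 0 := by exact_mod_cast hκ0 j hj
    have hDj : (D j : ℚ) ≠ 0 := by exact_mod_cast hD0 j hj
    have hN'j : (N' j : ℚ) ≠ 0 := by exact_mod_cast (hN' j hj).ne'
    rw [hc] at hcj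
    rcases div_eq_zero_iff.1 hcj with h | h
    · rcases mul_eq_zero.1 h with h | h
      · rcases mul_eq_zero.1 h with h | h
        · exact h
        · exact absurd h (pow_ne_zero 2 hDj)
      · exact absurd h hκj
    · exact absurd h hN'j
  -- (11) the `ω`-bracket: `pⱼ = 0` (radical independence of the `ρⱼ`)
  obtain ⟨c', hc'⟩ : ∃ c' : Fin k → ℚ, ∀ j, c' j = p j * κ j := ⟨_, fun j => rfl⟩
  have hA' : ∀ j ∈ S, Acoef j = (((c' j : ℝ) * ρ j : ℝ) : ℂ) := by
    intro j hj
    rw [hA, hq0 j hj, hc']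
    push_cast
    ring
  have hA0' : ∑ j ∈ S, (c' j : ℝ) * ρ j = 0 := by
    have h1 : ((∑ j ∈ S, (c' j : ℝ) * ρ j : ℝ) : ℂ) = 0 := by
      rw [ofReal_sum, ← hA0]
      exact Finset.sum_congr rfl fun j hj => (hA' j hj).symm
    exact_mod_cast h1
  intro j hj
  refine ⟨?_, hq0 j hj⟩
  have hcj := radical_indep_finset_pow (∏ i ∈ S, d i) hm k S ρ c' hρpos hxm hirr hA0' j hj
  rw [hc'] at hcj
  have hκj : (κ j : ℚ) ≠ 0 := by exact_mod_cast hκ0 j hj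
  rcases mul_eq_zero.1 hcj with h | h
  · exact h
  · exact absurd h hκj

end Summit.KontsevichZagierPeriods.IsogenyCertificates.XMapKernelStubs.CMClassEta

end
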